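import Summits.AtomisticToContinuum.Crystallization.Theorems.GappedShellCensusCleanLimitsHaveWindowsInplaneGainDefs

/-!
# `CleanLimitsHaveWindows` (stmt-AtomisticToContinuum-15932), line `Sketch`, stub `stub_inplaneGain`, helper 1:
# scalar Lennard-Jones facts and the geometry of the two cosets

Support file for the certified in-plane gain (stub `stub_inplaneGain` of the skeleton of line `Sketch` of the crux
`GappedShellCensus.CleanLimitsHaveWindows`). Every site of a layered set contributes to the site energy of a point
the term `E(q) = (1/12) q⁻⁶ - (1/6) q⁻³` (`igE`) with `q = a² P + H²`, `P = P_δ(i,j) = (i + j/2 + δ/2)² +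
(3/4)(j + δ/3)²` (`igP`) the normalised in-plane form of `…Convexity3` (definitions in `…InplaneGainDefs`). This
file proves:

* the one-sided Taylor bound `E(q) - E(q') ≥ (q - q')(1 - q'⁻³)/(2 q⁴)` for `q, q' ≥ 1` (`ig_taylor`), from the
  factorisation `E(q) - E(q') = (q⁻³ - q'⁻³)(q⁻³ + q'⁻³ - 2)/12` and an explicit sum-of-products certificate;
* the nearest-neighbour term `E(A) - E(ΛA)` as a quadratic in `x = A⁻³` and its monotonicity in `A` for the two
  strains `Λ = (199/200)²` (increasing) and `Λ = (201/200)²` (decreasing) (`ig_nn_mono_U`, `ig_nn_mono_L`);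
* the arithmetic of the cosets: `P_0(i,j) = i² + ij + j² ∈ {0, 1} ∪ [3, ∞)` (`ig_P0_trichotomy`),
  `P_1(i,j) ∈ {1/3} ∪ [4/3, ∞)` (`ig_P1_dichotomy`), and the shell bound `P_0 ≥ (3/4)(r - 1/3)² + 5/12` off the
  origin (`ig_P0_ge_shell`).
-/

noncomputable section

namespace Summit.AtomisticToContinuum.Crystallization.Theorems.CleanHull

open Summit.AtomisticToContinuum.Crystallization.Theorems.LayeredHull

/-! ## The site term -/

/-- `E(0) = 0` (junk value of the inverse). [folklore] -/
theorem ig_E_zero : igE 0 = 0 := by simp [igE]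

/-- **Factorisation of differences of the site term.** [folklore] -/
theorem ig_E_sub (q q' : ℝ) :
    igE q - igE q' = ((q⁻¹) ^ 3 - (q'⁻¹) ^ 3) * ((q⁻¹) ^ 3 + (q'⁻¹) ^ 3 - 2) / 12 := by
  unfold igE; ring

/-- The Taylor certificate in the inverse variables `u = q⁻¹`, `v = q'⁻¹ ∈ (0, 1]`:
`(v - u)(1 - v³) u³ / (2v) ≤ (u⁶/12 - u³/6) - (v⁶/12 - v³/6)`; the difference times `12 v` is
`(u - v)² (v²(2 - v³) + uv(4 - 2v³) + u²(6 - 3v³) + 2u³v² + u⁴v) ≥ 0`. [folklore] -/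
theorem ig_taylor_core {u v : ℝ} (hu0 : 0 ≤ u) (hv0 : 0 < v) (hv1 : v ≤ 1) :
    (v - u) * (1 - v ^ 3) * u ^ 3 / (2 * v) ≤
      (1 / 12 * u ^ 6 - 1 / 6 * u ^ 3) - (1 / 12 * v ^ 6 - 1 / 6 * v ^ 3) := by
  have hv3 : v ^ 3 ≤ 1 := pow_le_one₀ hv0.le hv1
  have hQ : 0 ≤ v ^ 2 * (2 - v ^ 3) + u * v * (4 - 2 * v ^ 3) + u ^ 2 * (6 - 3 * v ^ 3) +
      2 * u ^ 3 * v ^ 2 + u ^ 4 * v := by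
    have h1 : 0 ≤ v ^ 2 * (2 - v ^ 3) := mul_nonneg (by positivity) (by linarith)
    have h2 : 0 ≤ u * v * (4 - 2 * v ^ 3) := mul_nonneg (by positivity) (by linarith)
    have h3 : 0 ≤ u ^ 2 * (6 - 3 * v ^ 3) := mul_nonneg (by positivity) (by linarith)
    positivity
  have hD : 0 ≤ v * (u ^ 6 - v ^ 6) - 2 * v * (u ^ 3 - v ^ 3) - 6 * ((v - u) * (1 - v ^ 3) * u ^ 3) := by
    have e : v * (u ^ 6 - v ^ 6) - 2 * v * (u ^ 3 - v ^ 3) - 6 * ((v - u) * (1 - v ^ 3) * u ^ 3) =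
        (u - v) ^ 2 * (v ^ 2 * (2 - v ^ 3) + u * v * (4 - 2 * v ^ 3) + u ^ 2 * (6 - 3 * v ^ 3) +
          2 * u ^ 3 * v ^ 2 + u ^ 4 * v) := by ring
    rw [e]; exact mul_nonneg (sq_nonneg _) hQ
  rw [div_le_iff₀ (by positivity)]
  nlinarith [hD]

/-- **One-sided Taylor bound for the site term**: for `q, q' ≥ 1`,
`(q - q')(1 - q'⁻³)/(2q⁴) ≤ E(q) - E(q')` (both when `q' ≤ q`, a gain, and when `q' ≥ q`, a loss).
[folklore] -/
theorem ig_taylor {q q' : ℝ} (hq : 1 ≤ q) (hq' : 1 ≤ q') :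
    (q - q') * (1 - (q'⁻¹) ^ 3) / (2 * q ^ 4) ≤ igE q - igE q' := by
  have hq0 : 0 < q := by linarith
  have hq0' : 0 < q' := by linarith
  set u := q⁻¹ with hu
  set v := q'⁻¹ with hv
  have hu0 : 0 < u := inv_pos.2 hq0
  have hv0 : 0 < v := inv_pos.2 hq0'
  have hv1 : v ≤ 1 := inv_le_one_of_one_le₀ hq'
  have hqu : q = u⁻¹ := by rw [hu, inv_inv]
  have hqv : q' = v⁻¹ := by rw [hv, inv_inv]
  have hcore := ig_taylor_core hu0.le hv0 hv1
  have e1 : (q - q') * (1 - v ^ 3) / (2 * q ^ 4) = (v - u) * (1 - v ^ 3) * u ^ 3 / (2 * v) := by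
    rw [hqu, hqv]
    field_simp
  have e2 : igE q - igE q' = (1 / 12 * u ^ 6 - 1 / 6 * u ^ 3) - (1 / 12 * v ^ 6 - 1 / 6 * v ^ 3) := by
    simp only [igE, hu, hv]
  rw [e1, e2]
  exact hcore

/-- Moving a site closer inside the increasing region is a gain: `1 ≤ q' ≤ q → 0 ≤ E(q) - E(q')`. [folklore] -/
theorem ig_gain_nonneg {q q' : ℝ} (hq' : 1 ≤ q') (hqq : q' ≤ q) : 0 ≤ igE q - igE q' := by
  have h := ig_taylor (le_trans hq' hqq) hq'
  have h1 : 0 ≤ (q - q') * (1 - (q'⁻¹) ^ 3) / (2 * q ^ 4) := by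
    have : (q'⁻¹) ^ 3 ≤ 1 := pow_le_one₀ (by positivity) (inv_le_one_of_one_le₀ hq')
    have hq0 : 0 < q := by linarith
    apply div_nonneg (mul_nonneg (by linarith) (by linarith)) (by positivity)
  linarith

/-! ## The nearest-neighbour term -/

/-- **The nearest-neighbour term as a quadratic in `x = A⁻³`**: for `A, Λ ≠ 0`,
`E(A) - E(ΛA) = x²(1 - L²)/12 + x(L - 1)/6` with `L = Λ⁻³`. [folklore] -/
theorem ig_nn_eq (A Λ : ℝ) :
    igE A - igE (Λ * A) =
      ((A⁻¹) ^ 3) ^ 2 * (1 - ((Λ⁻¹) ^ 3) ^ 2) / 12 + (A⁻¹) ^ 3 * ((Λ⁻¹) ^ 3 - 1) / 6 := by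
  unfold igE
  rw [mul_inv]
  ring

/-- Monotonicity of the quadratic `φ(x) = x²(1 - L²)/12 + x(L - 1)/6`: for `x' ≤ x` with `(x + x')(1 + L) ≥ 2`,
`φ(x) - φ(x') = (x - x')(L - 1)(2 - (x + x')(1 + L))/12`, which is `≤ 0` if `L ≥ 1` and `≥ 0` if `L ≤ 1`. [folklore] -/
theorem ig_phi_sub (x x' L : ℝ) :
    (x ^ 2 * (1 - L ^ 2) / 12 + x * (L - 1) / 6) - (x' ^ 2 * (1 - L ^ 2) / 12 + x' * (L - 1) / 6) =
      (x - x') * (L - 1) * (2 - (x + x') * (1 + L)) / 12 := by ring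

/-- **The nearest-neighbour term is increasing in `A = a²` for the contraction `Λ = (199/200)²`** on
`A ∈ (0, 11/10]`: `E(A) - E(ΛA) ≤ E(A') - E(ΛA')` for `0 < A ≤ A' ≤ 11/10`. [folklore] -/
theorem ig_nn_mono_U {A A' : ℝ} (hA : 0 < A) (hAA : A ≤ A') (hA' : A' ≤ 11 / 10) :
    igE A - igE (39601 / 40000 * A) ≤ igE A' - igE (39601 / 40000 * A') := by
  have hA'0 : 0 < A' := lt_of_lt_of_le hA hAA
  rw [ig_nn_eq, ig_nn_eq]
  set L : ℝ := ((39601 / 40000 : ℝ)⁻¹) ^ 3 with hL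
  set x : ℝ := (A⁻¹) ^ 3 with hx
  set x' : ℝ := (A'⁻¹) ^ 3 with hx'
  have hL1 : 1 ≤ L := by rw [hL]; norm_num
  have hL2 : L ≤ 2 := by rw [hL]; norm_num
  have hxx : x' ≤ x := by
    rw [hx, hx']; exact pow_le_pow_left₀ (by positivity) (inv_anti₀ hA hAA) 3
  have hx'lo : (10 / 11 : ℝ) ^ 3 ≤ x' := by
    rw [hx']
    apply pow_le_pow_left₀ (by norm_num)
    rw [show (10 / 11 : ℝ) = (11 / 10)⁻¹ by norm_num]
    exact inv_anti₀ hA'0 hA'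
  have hsum : 2 ≤ (x + x') * (1 + L) := by nlinarith
  have key := ig_phi_sub x x' L
  have hprod : (x - x') * (L - 1) * (2 - (x + x') * (1 + L)) / 12 ≤ 0 := by
    apply div_nonpos_of_nonpos_of_nonneg _ (by norm_num)
    apply mul_nonpos_of_nonneg_of_nonpos (mul_nonneg (by linarith) (by linarith)) (by linarith)
  linarith

/-- **The nearest-neighbour term is decreasing in `A = a²` for the expansion `Λ = (201/200)²`** on
`A ∈ (0, 11/10]`: `E(A') - E(ΛA') ≤ E(A) - E(ΛA)` for `0 < A ≤ A' ≤ 11/10`. [folklore] -/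
theorem ig_nn_mono_L {A A' : ℝ} (hA : 0 < A) (hAA : A ≤ A') (hA' : A' ≤ 11 / 10) :
    igE A' - igE (40401 / 40000 * A') ≤ igE A - igE (40401 / 40000 * A) := by
  have hA'0 : 0 < A' := lt_of_lt_of_le hA hAA
  rw [ig_nn_eq, ig_nn_eq]
  set L : ℝ := ((40401 / 40000 : ℝ)⁻¹) ^ 3 with hL
  set x : ℝ := (A⁻¹) ^ 3 with hx
  set x' : ℝ := (A'⁻¹) ^ 3 with hx'
  have hL1 : L ≤ 1 := by rw [hL]; norm_num
  have hL2 : 9 / 10 ≤ L := by rw [hL]; norm_num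
  have hxx : x' ≤ x := by
    rw [hx, hx']; exact pow_le_pow_left₀ (by positivity) (inv_anti₀ hA hAA) 3
  have hx'lo : (10 / 11 : ℝ) ^ 3 ≤ x' := by
    rw [hx']
    apply pow_le_pow_left₀ (by norm_num)
    rw [show (10 / 11 : ℝ) = (11 / 10)⁻¹ by norm_num]
    exact inv_anti₀ hA'0 hA'
  have hsum : 2 ≤ (x + x') * (1 + L) := by
    have h1 : 2 * (10 / 11 : ℝ) ^ 3 ≤ x + x' := by linarith
    have h2 : (19 / 10 : ℝ) ≤ 1 + L := by linarith
    have h3 := mul_le_mul h1 h2 (by norm_num) (by linarith)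
    have h4 : (2 : ℝ) ≤ 2 * (10 / 11) ^ 3 * (19 / 10) := by norm_num
    exact h4.trans h3
  have key := ig_phi_sub x x' L
  have hprod : 0 ≤ (x - x') * (L - 1) * (2 - (x + x') * (1 + L)) / 12 := by
    apply div_nonneg _ (by norm_num)
    have : 0 ≤ (x - x') * (1 - L) * ((x + x') * (1 + L) - 2) :=
      mul_nonneg (mul_nonneg (by linarith) (by linarith)) (by linarith)
    nlinarith
  linarith

/-! ## The two cosets -/

/-- The aligned coset: `P_0(i,j) = i² + ij + j²`. [folklore] -/
theorem ig_P0_eq (p : ℤ × ℤ) : igP 0 p = ((p.1 ^ 2 + p.1 * p.2 + p.2 ^ 2 : ℤ) : ℝ) := by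
  unfold igP; push_cast; ring

/-- The offset coset: `12 P_1(i,j) = 3(2i + j + 1)² + (3j + 1)²`. [folklore] -/
theorem ig_P1_eq (p : ℤ × ℤ) :
    igP 1 p = ((3 * (2 * p.1 + p.2 + 1) ^ 2 + (3 * p.2 + 1) ^ 2 : ℤ) : ℝ) / 12 := by
  unfold igP; push_cast; ring

/-- **Trichotomy on the aligned coset**: `i² + ij + j² = 0`, `= 1`, or `≥ 3`. [folklore] -/
theorem ig_P0_trichotomy (p : ℤ × ℤ) : igP 0 p = 0 ∨ igP 0 p = 1 ∨ 3 ≤ igP 0 p := by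
  obtain ⟨i, j⟩ := p
  have hint : i ^ 2 + i * j + j ^ 2 = 0 ∨ i ^ 2 + i * j + j ^ 2 = 1 ∨ 3 ≤ i ^ 2 + i * j + j ^ 2 := by
    rcases le_or_gt 2 |j| with hj | hj
    · right; right
      nlinarith [abs_mul_abs_self j, sq_nonneg (2 * i + j), abs_nonneg j]
    rcases le_or_gt 2 |i| with hi | hi
    · right; right
      nlinarith [abs_mul_abs_self i, sq_nonneg (2 * j + i), abs_nonneg i]
    have hi' : -1 ≤ i ∧ i ≤ 1 := by constructor <;> linarith [abs_le.1 (show |i| ≤ 1 by omega)]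
    have hj' : -1 ≤ j ∧ j ≤ 1 := by constructor <;> linarith [abs_le.1 (show |j| ≤ 1 by omega)]
    obtain ⟨hi1, hi2⟩ := hi'
    obtain ⟨hj1, hj2⟩ := hj'
    interval_cases i <;> interval_cases j <;> decide
  rw [ig_P0_eq]
  rcases hint with h | h | h
  · left; rw [h]; simp
  · right; left; rw [h]; simp
  · right; right; exact_mod_cast h

/-- **Dichotomy on the offset coset**: `P_1(i,j) = 1/3` or `P_1(i,j) ≥ 4/3`. [folklore] -/
theorem ig_P1_dichotomy (p : ℤ × ℤ) : igP 1 p = 1 / 3 ∨ 4 / 3 ≤ igP 1 p := by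
  obtain ⟨i, j⟩ := p
  have hint : 3 * (2 * i + j + 1) ^ 2 + (3 * j + 1) ^ 2 = 4 ∨ 16 ≤ 3 * (2 * i + j + 1) ^ 2 + (3 * j + 1) ^ 2 := by
    rcases le_or_gt 2 |j| with hj | hj
    · right
      have h1 : 5 ≤ |3 * j + 1| := by
        rcases abs_cases j with ⟨h, _⟩ | ⟨h, _⟩ <;> rw [abs_eq_max_neg] <;> omega
      nlinarith [abs_mul_abs_self (3 * j + 1), sq_nonneg (2 * i + j + 1), abs_nonneg (3 * j + 1)]
    rcases le_or_gt 3 |i| with hi | hi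
    · right
      have h1 : 4 ≤ |2 * i + j + 1| := by
        have := abs_le.1 (show |j| ≤ 1 by omega)
        rcases abs_cases i with ⟨h, _⟩ | ⟨h, _⟩ <;> rw [abs_eq_max_neg] <;> omega
      nlinarith [abs_mul_abs_self (2 * i + j + 1), sq_nonneg (3 * j + 1), abs_nonneg (2 * i + j + 1)]
    have hi' : -2 ≤ i ∧ i ≤ 2 := by constructor <;> linarith [abs_le.1 (show |i| ≤ 2 by omega)]
    have hj' : -1 ≤ j ∧ j ≤ 1 := by constructor <;> linarith [abs_le.1 (show |j| ≤ 1 by omega)]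
    obtain ⟨hi1, hi2⟩ := hi'
    obtain ⟨hj1, hj2⟩ := hj'
    interval_cases i <;> interval_cases j <;> decide
  rw [ig_P1_eq]
  rcases hint with h | h
  · left; rw [h]; norm_num
  · right
    have : (16 : ℝ) ≤ ((3 * (2 * i + j + 1) ^ 2 + (3 * j + 1) ^ 2 : ℤ) : ℝ) := by exact_mod_cast h
    linarith

/-- **Shell bound on the aligned coset with a margin**: for `r = max(|i|,|j|) ≥ 1`,
`(3/4)(r - 1/3)² + 5/12 ≤ P_0(i,j)` (since `P_0 ≥ (3/4) r²`). [folklore] -/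
theorem ig_P0_ge_shell (p : ℤ × ℤ) (hr : 1 ≤ max |p.1| |p.2|) :
    3 / 4 * (((max |p.1| |p.2| : ℤ) : ℝ) - 1 / 3) ^ 2 + 5 / 12 ≤ igP 0 p := by
  obtain ⟨i, j⟩ := p
  simp only at hr ⊢
  have hr1 : (1 : ℝ) ≤ ((max |i| |j| : ℤ) : ℝ) := by exact_mod_cast hr
  have hP : igP 0 (i, j) = (i : ℝ) ^ 2 + i * j + j ^ 2 := by unfold igP; push_cast; ring
  rw [hP]
  have key : 3 / 4 * (((max |i| |j| : ℤ) : ℝ)) ^ 2 ≤ (i : ℝ) ^ 2 + i * j + j ^ 2 := by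
    rcases le_total |i| |j| with hij | hij
    · rw [max_eq_right hij]
      have : (((|j| : ℤ) : ℝ)) ^ 2 = (j : ℝ) ^ 2 := by push_cast; exact sq_abs _
      rw [this]; nlinarith [sq_nonneg ((i : ℝ) + j / 2)]
    · rw [max_eq_left hij]
      have : (((|i| : ℤ) : ℝ)) ^ 2 = (i : ℝ) ^ 2 := by push_cast; exact sq_abs _
      rw [this]; nlinarith [sq_nonneg ((j : ℝ) + i / 2)]
  nlinarith

end Summit.AtomisticToContinuum.Crystallization.Theorems.CleanHull

end
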